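import Summits.HodgeConjecture.HodgeConjecture.Theorems.F0P3cStCharTSAdRegularisedDescent   -- ★-cand p851844 (this seat) C7 file 2: `det_eq_neg_discr_div_det_sq` (K-level C7)
import Summits.HodgeConjecture.HodgeConjecture.Theorems.F0P3cStCharTSDGField                -- ★ p851395 DG-FIELD: the (S-𝔇) datum's `D_G` field equation `hDG`
import HarnessLib

/-!
# F0 · P3c · line LH6 «StCharTS» — ROAD «JAC-ELL» brick C7 (file 3 ∕ 3) «WEIGHT-ID elliptic»: the `F`-FORM transfer `det_F L̃ = det_K Φ = −disc(χ_{t₀})∕det(t₀)²` for the road's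
# linear part `L̃ = (Ad t₀⁻¹ − 1) ∘ pr_𝔪 + pr_𝔱` on the Lie algebra `𝔤 ⊂ M₃(K)`, and the norm reading `(𝔇.DG)² = (|disc|_w ∕ |det|_w²)^{1∕2}` (Rogawski 1990 §4.9, §12.5; Harish-Chandra 1970 L. 22)

Cell `pub/hodgecm-mathlib`, crux H413 = `stmt-HodgeConjecture-24833` (lane `--supports … --as helper`), route HCCMUnconditional; seat LH6-p02 (g6), brick C7 of LH5-p02 (g6)'s road
«JAC-ELL» (memo `F0/P3c/LH5/LH5-p02/g6/ROAD-JAC-ELL.v0.LH5p02g6.md`; dress «A′ + B + C» F0∕P3c 2026-09-02T15:05:53Z: C8's linear part is `L̃ := (Ad t₀⁻¹ − 1) ∘ pr_𝔪 + pr_𝔱 :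
𝔤 ≃L[F] 𝔤`, `F`-linear, block-diagonal on `𝔤 = 𝔪 ⊕ 𝔱`, and «the weight enters as `distribHaarChar F (Units.mk0 P _) = |P|_v = (𝔇.DG (ι t₀))²`»).  THEOREMS ONLY; imports ★-cand file 2
+ ★ DG-FIELD.  HONEST LABEL: HC_CM is proved only modulo the 7 printed citations (2 remaining: hLiu418 = `stmt-HodgeConjecture-24832`, h413 = `stmt-HodgeConjecture-24833`) until rung 0
closes; count-neutral algebra for the ELLIPTIC half of the print residue «WIF» of the (S-𝔇) organ `stub_EllipticPackage`; closes no organ.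

(A′) THE `F`-FORM TRANSFER (generic): `V` an `F`-space with basis `b`, `W` a `K`-space (`K ⊇ F`) with basis `b′` indexed alike, `ι : V →ₗ[F] W` with `ι (b i) = b′ i` (an `F`-FORM of `W`:
for C8, `V = 𝔤 = 𝔲(Φ₃)`, `W = M₃(K)`, `b` = matrix-entry coordinates), `L : V →ₗ[F] V` and `Φ : W →ₗ[K] W` with `Φ ∘ ι = ι ∘ L` ⟹ the matrices of `L` in `b` and of `Φ` in `b′` coincide
after `algebraMap`, so **`algebraMap F K (det L) = det Φ`** (`det_extends_eq_algebraMap_det`); with ★ file 2: if `Φ` is a regularised Jacobian operator for a regular semisimple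
`t ∈ GL₃(K)` then **`algebraMap F K (det L) = −disc(χ_t)∕det(t)²`** (`algebraMap_det_eq_neg_discr_div_det_sq`) — C8's `L̃` qualifies (it is `Ad t₀⁻¹ − 1` on `𝔪 = (Ad t₀ − 1)𝔤` and `id`
on `𝔱 = 𝔷_𝔤(t₀)`, and its `K`-linear extension to `M₃(K) = 𝔤 ⊕ δ𝔤` keeps both properties).
(B∕C) THE NORM READING in RUNG0's normalisation (★ DG-FIELD `hDG`: `𝔇.DG g = (∏_w |disc χ_g|_w · (∏_w |det g|_w)⁻²)^{1∕4}`): **`(𝔇.DG g)² = √(∏_w |disc χ_g|_w · (∏_w |det g|_w)⁻²)`** and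
**`(𝔇.DG g)⁴ = ∏_w |disc χ_g|_w · (∏_w |det g|_w)⁻²`** (`DG_sq_eq_sqrt`, `DG_pow_four_eq`) — i.e. `(𝔇.DG g)² = |P|_w^{1∕2}` for `P = −disc∕det²` at the unique `w ∣ v` (non-split), which is
`|P|_v = distribHaarChar F_v P` for `P ∈ F_v` (`|x|_w = |x|_v²`, the C6∕C8 modulus dictionary of LH10-p01).  Local constancy of `t ↦ (𝔇.DG t)²` at regular points: ★
`F0P3cStCharTSDGLc.DG_eventually_eq_of_mem_regG` (F0P3-p02), cited, not retyped.

## References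
* [Rogawski1990] J. D. Rogawski, *Automorphic Representations of Unitary Groups in Three Variables*, Ann. of Math. Stud. 123 (1990), §4.9 p. 54 (`D_G`), §12.5 p. 182 (WIF).
* [HarishChandra1970] Harish-Chandra, *Harmonic analysis on reductive p-adic groups*, LNM 162 (1970), Lemma 22.
-/

set_option autoImplicit false
-- the mandated namespace has the single-problem summit's repeated segment (`HodgeConjecture.HodgeConjecture`)
set_option linter.dupNamespace false

noncomputable section

open Matrix Polynomial NumberField IsDedekindDomain
open scoped MatrixGroups NNReal
open Literature.NumberTheory.Rogawski1990 Literature.NumberTheory.Automorphic Literature.NumberTheory.Automorphic.UnitaryGroup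

namespace Summit.HodgeConjecture.HodgeConjecture.Cruxes.H413.F0P3cStCharTSWeightIdElliptic

/-! ## §1 (A′) Determinants on an `F`-form -/

section FForm

variable {F K : Type*} [Field F] [Field K] [Algebra F K]
  {V : Type*} [AddCommGroup V] [Module F V] {W : Type*} [AddCommGroup W] [Module K W] [Module F W] [IsScalarTower F K W]
  {m : Type*} [Fintype m] [DecidableEq m]

/-- **`F`-FORM TRANSFER OF MATRICES**: if `ι (b i) = b′ i` and `Φ ∘ ι = ι ∘ L`, the matrix of `Φ` in `b′` is the matrix of `L` in `b` pushed along `algebraMap F K`. [folklore] -/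
theorem toMatrix_extends_eq_map (ι : V →ₗ[F] W) (b : Module.Basis m F V) (b' : Module.Basis m K W) (hb : ∀ i, ι (b i) = b' i)
    (L : V →ₗ[F] V) (Φ : W →ₗ[K] W) (hcomm : ∀ v, Φ (ι v) = ι (L v)) :
    LinearMap.toMatrix b' b' Φ = (LinearMap.toMatrix b b L).map (algebraMap F K) := by
  ext i j
  rw [Matrix.map_apply, LinearMap.toMatrix_apply, LinearMap.toMatrix_apply, ← hb j, hcomm]
  have hL : L (b j) = ∑ k, b.repr (L (b j)) k • b k := (b.sum_repr (L (b j))).symm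
  rw [hL, map_sum]
  simp_rw [LinearMap.map_smul_of_tower, hb, ← algebraMap_smul K (b.repr (L (b j)) _) (b' _), map_sum, map_smul, Module.Basis.repr_self,
    Finsupp.smul_single, smul_eq_mul, mul_one, Finset.sum_apply', Finsupp.single_apply]
  rw [map_sum]
  refine Finset.sum_congr rfl fun x _ => ?_
  split_ifs <;> simp

/-- **`algebraMap F K (det L) = det Φ`** for an `F`-form `ι : V → W` carrying the basis `b` to the basis `b′` and `Φ ∘ ι = ι ∘ L`. [folklore] -/
theorem det_extends_eq_algebraMap_det (ι : V →ₗ[F] W) (b : Module.Basis m F V) (b' : Module.Basis m K W) (hb : ∀ i, ι (b i) = b' i)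
    (L : V →ₗ[F] V) (Φ : W →ₗ[K] W) (hcomm : ∀ v, Φ (ι v) = ι (L v)) :
    algebraMap F K (LinearMap.det L) = LinearMap.det Φ := by
  rw [← LinearMap.det_toMatrix b, ← LinearMap.det_toMatrix b', toMatrix_extends_eq_map ι b b' hb L Φ hcomm, RingHom.map_det, RingHom.mapMatrix_apply]

/-- **C7 (A′): `det_F L = −disc(χ_t) ∕ det(t)²`** for the road's `F`-linear part `L` (`= Ad_{t⁻¹} − 1` on `𝔪`, `id` on `𝔱`) on an `F`-form `V` (`= 𝔤`) of `M₃(K)`, read through its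
`K`-linear extension `Φ` (a regularised Jacobian operator for the regular semisimple `t ∈ GL₃(K)`, ★ file 2 `det_eq_neg_discr_div_det_sq`).
[cite: HarishChandra1970, Lemma 22] [cite: Rogawski1990, §4.9 p. 54; §12.5 p. 182] -/
theorem algebraMap_det_eq_neg_discr_div_det_sq (ι : V →ₗ[F] Matrix (Fin 3) (Fin 3) K) (b : Module.Basis m F V) (b' : Module.Basis m K (Matrix (Fin 3) (Fin 3) K))
    (hb : ∀ i, ι (b i) = b' i) (L : V →ₗ[F] V) (Φ : Matrix (Fin 3) (Fin 3) K →ₗ[K] Matrix (Fin 3) (Fin 3) K) (hcomm : ∀ v, Φ (ι v) = ι (L v))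
    (t : GL (Fin 3) K) (hsep : (t : Matrix (Fin 3) (Fin 3) K).charpoly.Separable)
    (h1 : Φ ∘ₗ (LinearMap.mulLeftRight K ((t : Matrix (Fin 3) (Fin 3) K), ((t⁻¹ : GL (Fin 3) K) : Matrix (Fin 3) (Fin 3) K)) - LinearMap.id) =
      (LinearMap.mulLeftRight K (((t⁻¹ : GL (Fin 3) K) : Matrix (Fin 3) (Fin 3) K), (t : Matrix (Fin 3) (Fin 3) K)) - LinearMap.id) ∘ₗ
        (LinearMap.mulLeftRight K ((t : Matrix (Fin 3) (Fin 3) K), ((t⁻¹ : GL (Fin 3) K) : Matrix (Fin 3) (Fin 3) K)) - LinearMap.id))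
    (h2 : ∀ Z : Matrix (Fin 3) (Fin 3) K, Z * (t : Matrix (Fin 3) (Fin 3) K) = (t : Matrix (Fin 3) (Fin 3) K) * Z → Φ Z = Z) :
    algebraMap F K (LinearMap.det L) = -((t : Matrix (Fin 3) (Fin 3) K).charpoly.discr) / ((t : Matrix (Fin 3) (Fin 3) K).det) ^ 2 := by
  rw [det_extends_eq_algebraMap_det ι b b' hb L Φ hcomm]
  exact F0P3cStCharTSAdRegularisedDescent.det_eq_neg_discr_div_det_sq t hsep Φ h1 h2

end FForm

/-! ## §2 (B∕C) The norm reading of `D_G` in RUNG0's normalisation -/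

section Norm

variable (L : Type) [Field L] [NumberField L] [IsCMField L] (v : HeightOneSpectrum (𝓞 ↥(maximalRealSubfield L)))
  {H : Type} [Group H] [TopologicalSpace H] [IsTopologicalGroup H] [MeasurableSpace H]

/-- **`(𝔇.DG g)² = √(∏_w |disc χ_g|_w · (∏_w |det g|_w)⁻²)`** under the (S-𝔇) datum's `D_G` field equation (★ DG-FIELD `hDG`): the square of the Weyl discriminant is the square
root of `|disc(χ_g) ∕ det(g)²|` — the elliptic tube-Jacobian weight `|det L̃|` of the road, read at the non-split place. [cite: Rogawski1990, §4.9 p. 54; §12.5 p. 182] -/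
theorem DG_sq_eq_sqrt [MeasurableSpace (Gqs L v)]
    [∀ γ : Gqs L v, MeasurableSpace (Gqs L v ⧸ Subgroup.centralizer ({γ} : Set (Gqs L v)))] [MeasurableSpace (Gqs L v ⧸ Subgroup.center (Gqs L v))]
    (𝔇 : Ch12Sec5.EllipticData (Gqs L v) H)
    (hDG : ∀ g : Gqs L v, 𝔇.DG g =
      ((NNReal.sqrt (NNReal.sqrt
        ((∏ w : PlacesOver L v, Literature.NumberTheory.GaloisRepresentations.IsNonarchimedeanLocalField.normAbs (w.1.adicCompletion L)
            (((g.val : GL (Fin 3) (UnitaryGroup.LocalRing L v)).val.charpoly.discr) w)) *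
          ((∏ w : PlacesOver L v, Literature.NumberTheory.GaloisRepresentations.IsNonarchimedeanLocalField.normAbs (w.1.adicCompletion L)
            (((g.val : GL (Fin 3) (UnitaryGroup.LocalRing L v)).val.det) w)) ^ 2)⁻¹)) : ℝ≥0) : ℝ))
    (g : Gqs L v) :
    (𝔇.DG g) ^ 2 = ((NNReal.sqrt
        ((∏ w : PlacesOver L v, Literature.NumberTheory.GaloisRepresentations.IsNonarchimedeanLocalField.normAbs (w.1.adicCompletion L)
            (((g.val : GL (Fin 3) (UnitaryGroup.LocalRing L v)).val.charpoly.discr) w)) *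
          ((∏ w : PlacesOver L v, Literature.NumberTheory.GaloisRepresentations.IsNonarchimedeanLocalField.normAbs (w.1.adicCompletion L)
            (((g.val : GL (Fin 3) (UnitaryGroup.LocalRing L v)).val.det) w)) ^ 2)⁻¹) : ℝ≥0) : ℝ) := by
  rw [hDG g, ← NNReal.coe_pow, NNReal.sq_sqrt]

/-- **`(𝔇.DG g)⁴ = ∏_w |disc χ_g|_w · (∏_w |det g|_w)⁻²`** — the same without roots. [cite: Rogawski1990, §4.9 p. 54] -/
theorem DG_pow_four_eq [MeasurableSpace (Gqs L v)]
    [∀ γ : Gqs L v, MeasurableSpace (Gqs L v ⧸ Subgroup.centralizer ({γ} : Set (Gqs L v)))] [MeasurableSpace (Gqs L v ⧸ Subgroup.center (Gqs L v))]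
    (𝔇 : Ch12Sec5.EllipticData (Gqs L v) H)
    (hDG : ∀ g : Gqs L v, 𝔇.DG g =
      ((NNReal.sqrt (NNReal.sqrt
        ((∏ w : PlacesOver L v, Literature.NumberTheory.GaloisRepresentations.IsNonarchimedeanLocalField.normAbs (w.1.adicCompletion L)
            (((g.val : GL (Fin 3) (UnitaryGroup.LocalRing L v)).val.charpoly.discr) w)) *
          ((∏ w : PlacesOver L v, Literature.NumberTheory.GaloisRepresentations.IsNonarchimedeanLocalField.normAbs (w.1.adicCompletion L)
            (((g.val : GL (Fin 3) (UnitaryGroup.LocalRing L v)).val.det) w)) ^ 2)⁻¹)) : ℝ≥0) : ℝ))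
    (g : Gqs L v) :
    (𝔇.DG g) ^ 4 = (((∏ w : PlacesOver L v, Literature.NumberTheory.GaloisRepresentations.IsNonarchimedeanLocalField.normAbs (w.1.adicCompletion L)
            (((g.val : GL (Fin 3) (UnitaryGroup.LocalRing L v)).val.charpoly.discr) w)) *
          ((∏ w : PlacesOver L v, Literature.NumberTheory.GaloisRepresentations.IsNonarchimedeanLocalField.normAbs (w.1.adicCompletion L)
            (((g.val : GL (Fin 3) (UnitaryGroup.LocalRing L v)).val.det) w)) ^ 2)⁻¹ : ℝ≥0) : ℝ) := by
  rw [show (4 : ℕ) = 2 * 2 from rfl, pow_mul, DG_sq_eq_sqrt L v 𝔇 hDG g, ← NNReal.coe_pow, NNReal.sq_sqrt]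

end Norm

end Summit.HodgeConjecture.HodgeConjecture.Cruxes.H413.F0P3cStCharTSWeightIdElliptic

end
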